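/-
Copyright (c) 2026 the pub-hodgecm-mathlib formalisation cell (harness21).  Prover seat hodgecm-mathlib-R90-C10-p01 (g3), SLAB R90-TF, section S1 «Ch. 10∕12 local»;
crux H413 = `stmt-HodgeConjecture-24833`; line «B_pos» RAMIFIED TAME corner (U4Keys :182, Branch B at positive depth, sub-branch (R-b)), brick (B-10)(7), dealt BY NAME by
R90-C10-plan (g2) in ruling R-S1-20 (2026-09-05T01:08:21Z) on this seat's cross-derivation `R90/R90-C10-p01/g3/PAPER-Pram1-cross.md` 285001636e231ee7.
KERNEL module: THEOREMS ONLY (no definition, no named fact, no `sorry`, no instance, no notation).  2026-09-05.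
-/
import Summits.HodgeConjecture.HodgeConjecture.Theorems.R90S1BranchBEndAssemblyRamified   -- ★ p05 (g0) d0-RAM frame-free end assembly: `coe_halfModulusChar_norm_uniformizer` (`‖σΠ·Π‖^{1∕2} = (N𝔓_w)⁻¹`); brings ★ Z4-ram `det_eq_zero_iff_of_norm_lt_one_ram` (the quadratic `(qX−1)(X−q)`, admissible root `q⁻¹`)
import Summits.HodgeConjecture.HodgeConjecture.Theorems.R90S1BposRamConversion            -- ★ (B-10)(7a) p863940 (R90-C10-p06 (g3)): `exists_eta_of_branchB_of_apply_norm_uniformizer_of_fixedUnit` (`hroot` + the sub-branch letter `hFε` ⟹ `χ₁ = η·‖·‖^{1∕2}`)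
import HarnessLib

/-!
# R90-TF · S1 «Ch10-local» ∕ K2 E3 «U4Keys» :182, BRANCH B AT POSITIVE DEPTH, TAME RAMIFIED PLACE — brick (B-10)(7) `R90S1BposRamDeterminantClosedForm`:
# THE CASSELMAN-PAIR DETERMINANT AT ROCHE'S LEVEL `J_e` IN CLOSED FORM, `det M = V₁V₂·q^{1−n}·det_{d0,ram}(X)`, ITS ADMISSIBLE ROOT `X = q⁻¹`, AND THE END ASSEMBLY
# `det M = 0 ⟹ χ₁ = η·‖·‖^{1∕2}` — HYPOTHESIS-FIRST over the two big-cell entries, the two volumes and ONE constant relation `Γ²·X = (q−1)²·q^{−n−1}`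
# [Keys1984 §7 Thm (2) (d); Casselman1980 §3; Roche1998 §3–§4; Rogawski1990 §12.2]

Cell `pub/hodgecm-mathlib`, crux H413 = `stmt-HodgeConjecture-24833`, route of record `HCCMUnconditional` (no route verbs); R90-TF section S1 (base R90-C10), dealer
R90-C10-plan (g2) (R-S1-20), line lead R90-C10-p05 (g2), auditor R90-C10-audit1 (g2).  THEOREMS ONLY; lane `--supports stmt-HodgeConjecture-24833 --as helper`, count-neutral.
NOT THE PAYER of :182 (the ramified leaf (8) `R90S1KeysThmTwoPosDepthBranchBRamifiedTameLeaf` assembles the type side, ★ (B-0), this file and ★ (7a)).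

THE POINT (`PAPER-Pram1-cross.md` §1–§4; R-S1-20 (1)).  At a TAME RAMIFIED place `v` (`E = L_w`, `q = N𝔓_w = N𝔭_v`, uniformiser `Π` with `σΠ = −Π`) with `χ₁` of conductor
`n = 2ν` (EVEN, ★ `R90S1BposRamConductorEven`) in Branch B, sub-branch (R-b) (`χ₁|_{𝒪_F^×} = ε`), the `(J_e, θ)`-plane of `i(χ₁, 1)` at `e = (ν, 0; ν, 1)` carries the `2 × 2` matrix
of `Λ_g φ = ∫_N φ(w₀ n g) dμ` (`g ∈ {1, w₀}`) on the normalised type basis, with — in the letters `X := χ₁(σΠ·Π)` (`|X| < 1`), Haar units `V₁, V₂ ≠ 0` of `N`, `N̄`, and ONE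
complex constant `Γ` (carrying the quadratic Gauss sum, `ε(2)`, `ε(−1)^{ν+1}` and `χ₁(−Π)⁻¹` — none of which this file needs to know) —
  `Λ_1 f₁ = V₁·Γ·X∕(1−X)` (`G₁`), `Λ_{w₀} f_w = V₂·Γ·X∕(1−X)` (`G₂ = G₁`: only the ODD shells survive, and the two thresholds differ by the EVEN shell `j = 0`),
  `Λ_1 f_w = q^{−ν}·V₁`, `Λ_{w₀} f₁ = q^{−ν}·V₂` (the two volumes `vol(N ∩ J_e) = vol(N̄ ∩ J_e) = q^{−ν}`), and **`Γ²·X = (q−1)²·q^{−n−1}`** (`g² = ε(−1)q`, `Π² = −ϖ_F`).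
THIS FILE is the closing algebra, HYPOTHESIS-FIRST over those five values∕relations as LETTERS (R-S1-20 (1): it waits for nothing; the analytic bricks (5)(6) pay the letters):
* §1 **`det_letters_eq_ram_posDepth`** — `Λ_1 f₁·Λ_{w₀} f_w − Λ_1 f_w·Λ_{w₀} f₁ = V₁V₂·(q^{−ν})²·q · ((q−1)²q⁻²·X∕(1−X)² − q⁻¹)` = `V₁V₂q^{1−n}` times the DEPTH-ZERO ramified
  bracket of ★ `R90S1BranchBEndAssemblyRamified.det_letters_eq_ram` (paper §3: `det M = −q^{−n−1}(qX−1)(X−q)∕(1−X)²`).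
* §2 **`eq_inv_of_det_eq_zero_ram_posDepth`** — `det M = 0`, `V₁, V₂ ≠ 0`, `|X| < 1 < q` ⟹ **`X = q⁻¹`** (★ Z4-ram `det_eq_zero_iff_of_norm_lt_one_ram`; the root `X = q` is excluded).
* §3 **`exists_eta_of_det_eq_zero_of_pairEntries_ram_posDepth`** (CM letters, frame-free; the positive-depth twin of ★ `exists_eta_of_det_eq_zero_of_pairEntries_ram`): at a non-split
  `v` with uniformiser unit `Π` (`|Π_{w′}| = exp(−1)`), `χ₁` continuous in Branch B with the sub-branch letter `hFε` of ★ (7a), the five letters + `det M = 0` ⟹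
  **`∃ η`, `IsQuadraticCharExtension σ η ∧ Continuous η ∧ χ₁ = η·halfModulusChar`** — DISJUNCT 2 of :182: §2 gives `X = (N𝔓_w)⁻¹ = ‖σΠ·Π‖^{1∕2}` (★
  `coe_halfModulusChar_norm_uniformizer`), i.e. ★ (7a)'s `hroot` VERBATIM, and ★ (7a) converts.  NO `hdepth`, NO `hram`, NO `|2|_w = 1`, NO `he` here (they enter the leaf).
* §4 **`det_ne_zero_of_bigCell_zero_ram`** — sub-branch (R-a) (`χ₁|_{𝒪_F^×} = 1`): there `G₁ = G₂ = 0` (paper §2: EVERY shell vanishes) and `det M = −q^{−n}V₁V₂ ≠ 0`, so «reducible»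
  (★ (B-0): `det M = 0`) is ABSURD — the leaf's (R-a) branch in one line.
HONEST LABEL.  HC_CM is proved only modulo the 7 printed citations (2 remaining named inputs: hLiu418 = `stmt-HodgeConjecture-24832`, h413 = `stmt-HodgeConjecture-24833`) until
rung 0 closes; count-neutral — this file is algebra over LETTERS and does NOT pay :182 or A2′; no printed citation is discharged; REL ≠ ★ ≠ BUILT.

## References
* [Keys1984] D. Keys, *Principal series representations of special unitary groups over local fields*, Compositio Math. 51 (1984), §3, §7 Theorem (2) (d) p. 126.
* [Casselman1980] W. Casselman, *The unramified principal series of p-adic groups I*, Compositio Math. 40 (1980), §3.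
* [Roche1998] A. Roche, *Types and Hecke algebras for principal series representations of split reductive p-adic groups*, Ann. Sci. ÉNS (4) 31 (1998), §3–§4.
* [Rogawski1990] J. Rogawski, *Automorphic Representations of Unitary Groups in Three Variables*, Ann. of Math. Stud. 123 (1990), §12.2 (1)–(2) p. 173.
-/

set_option autoImplicit false
-- the mandated namespace has the single-problem summit's repeated segment (`HodgeConjecture.HodgeConjecture`)
set_option linter.dupNamespace false

noncomputable section

open NumberField IsDedekindDomain
open scoped NNReal
open Literature.NumberTheory Literature.NumberTheory.Automorphic Literature.NumberTheory.Automorphic.UnitaryGroup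

namespace Summit.HodgeConjecture.HodgeConjecture.R90.S1.BposRamDeterminantClosedForm

open Summit.HodgeConjecture.HodgeConjecture.Cruxes.H413
open Summit.HodgeConjecture.HodgeConjecture.R90.S1

/-! ## §1 The closed form of the determinant -/

/-- **`det M` IN CLOSED FORM AT A TAME RAMIFIED PLACE, POSITIVE DEPTH.**  With `Λ_1 f₁ = V₁·Γ·X∕(1−X)`, `Λ_{w₀} f_w = V₂·Γ·X∕(1−X)`, `Λ_1 f_w = (q^ν)⁻¹·V₁`,
`Λ_{w₀} f₁ = (q^ν)⁻¹·V₂`, `Γ²·X = (q−1)²·(q^{2ν+1})⁻¹`, `q ≠ 0`, `1 − X ≠ 0`: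
`Λ_1 f₁·Λ_{w₀} f_w − Λ_1 f_w·Λ_{w₀} f₁ = V₁V₂·((q^ν)⁻¹)²·q · ((q−1)²(q²)⁻¹·X·((1−X)²)⁻¹ − q⁻¹)` — `V₁V₂·q^{1−n}` times the depth-zero ramified bracket of ★ `det_letters_eq_ram`
(paper §3: `det M = −q^{−n−1}(qX−1)(X−q)∕(1−X)²`, `n = 2ν`). [cite: Keys1984, §7 Theorem (2) (d) p. 126] [cite: Casselman1980, §3] [cite: Roche1998, §3–§4] -/
theorem det_letters_eq_ram_posDepth (q X Γ V₁ V₂ Λ11 Λ1w Λw1 Λww : ℂ) (ν : ℕ) (hq : q ≠ 0) (hX1 : 1 - X ≠ 0)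
    (h11 : Λ11 = V₁ * (Γ * X / (1 - X))) (hww : Λww = V₂ * (Γ * X / (1 - X)))
    (h1w : Λ1w = (q ^ ν)⁻¹ * V₁) (hw1 : Λw1 = (q ^ ν)⁻¹ * V₂)
    (hΓ : Γ ^ 2 * X = (q - 1) ^ 2 * (q ^ (2 * ν + 1))⁻¹) :
    Λ11 * Λww - Λw1 * Λ1w = (V₁ * V₂ * (((q ^ ν)⁻¹) ^ 2 * q)) * ((q - 1) ^ 2 * (q ^ 2)⁻¹ * X * ((1 - X) ^ 2)⁻¹ - q⁻¹) := by
  have hprod : Λ11 * Λww = V₁ * V₂ * (Γ ^ 2 * X) * X * ((1 - X) ^ 2)⁻¹ := by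
    rw [h11, hww]
    field_simp
  rw [hprod, hΓ, h1w, hw1]
  field_simp
  ring

/-! ## §2 The admissible root -/

/-- **THE ROOT FROM THE FIVE LETTERS AT A TAME RAMIFIED PLACE, POSITIVE DEPTH.**  For real `q > 1`, `|X| < 1`, `V₁, V₂ ≠ 0`, the two big-cell entries, the two volumes and the
constant relation as in `det_letters_eq_ram_posDepth`: `det M = 0` forces **`X = q⁻¹`** — after dividing by `V₁V₂q^{1−n} ≠ 0`, ★ Z4-ram `det_eq_zero_iff_of_norm_lt_one_ram`
(`(qX−1)(X−q) = 0`, and `X = q` is excluded by `|X| < 1 < q`).  In the leaf: `q = N𝔓_w`, `X = χ₁(σΠ·Π)`, `V₁ = μ_N(N₀)`, `V₂ = μ_{N̄}(N̄₀)`; the output is ★ (7a)'s `hroot`.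
[cite: Keys1984, §7 Theorem (2) (d) p. 126] [cite: Casselman1980, §3] [cite: Rogawski1990, §12.2 (1)–(2) p. 173] -/
theorem eq_inv_of_det_eq_zero_ram_posDepth (q : ℝ) (hq : 1 < q) (ν : ℕ) (X Γ V₁ V₂ Λ11 Λ1w Λw1 Λww : ℂ) (hX : ‖X‖ < 1)
    (hV₁ : V₁ ≠ 0) (hV₂ : V₂ ≠ 0)
    (h11 : Λ11 = V₁ * (Γ * X / (1 - X))) (hww : Λww = V₂ * (Γ * X / (1 - X)))
    (h1w : Λ1w = ((q : ℂ) ^ ν)⁻¹ * V₁) (hw1 : Λw1 = ((q : ℂ) ^ ν)⁻¹ * V₂)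
    (hΓ : Γ ^ 2 * X = ((q : ℂ) - 1) ^ 2 * ((q : ℂ) ^ (2 * ν + 1))⁻¹)
    (hdet : Λ11 * Λww - Λw1 * Λ1w = 0) :
    X = ((q : ℂ))⁻¹ := by
  have hq0 : (q : ℂ) ≠ 0 := by exact_mod_cast (ne_of_gt (lt_trans zero_lt_one hq))
  have hX1 : 1 - X ≠ 0 := by
    intro h
    have hXeq : X = 1 := by linear_combination -h
    rw [hXeq, norm_one] at hX
    exact lt_irrefl _ hX
  rw [det_letters_eq_ram_posDepth (q : ℂ) X Γ V₁ V₂ Λ11 Λ1w Λw1 Λww ν hq0 hX1 h11 hww h1w hw1 hΓ] at hdet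
  have hpre : V₁ * V₂ * ((((q : ℂ) ^ ν)⁻¹) ^ 2 * (q : ℂ)) ≠ 0 :=
    mul_ne_zero (mul_ne_zero hV₁ hV₂) (mul_ne_zero (pow_ne_zero 2 (inv_ne_zero (pow_ne_zero ν hq0))) hq0)
  have h := (mul_eq_zero.1 hdet).resolve_left hpre
  exact (det_eq_zero_iff_of_norm_lt_one_ram q hq X hX).1 h

/-! ## §3 The end assembly in the CM letters: `det M = 0 ⟹ χ₁ = η·‖·‖^{1∕2}` (sub-branch (R-b)) -/

section CM

variable (L : Type) [Field L] [NumberField L] [IsCMField L] (v : HeightOneSpectrum (𝓞 ↥(maximalRealSubfield L)))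
  (hns : ∀ w : PlacesOver L v, IsCMField.complexConj L • w.1 = w.1) (w : PlacesOver L v) (hw : IsCMField.complexConj L • w.1 = w.1)

include hns hw in
/-- **THE END ASSEMBLY FROM `det M = 0` AT A RAMIFIED PLACE, POSITIVE DEPTH, FRAME-FREE** (the twin of ★ `exists_eta_of_det_eq_zero_of_pairEntries_ram` with the entries at
conductor `n = 2ν` and ★ (7a)'s sub-branch letter in place of `hdepth`∕`hram`).  `v` non-split (`hns`, `hw`); `Π` a uniformiser unit of `R = L ⊗ L⁺_v` (`|Π_{w′}| = exp(−1)`);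
`χ₁` continuous with `χ₁(u·σu) = 1` on the units of valuation one (Branch B) and a σ-fixed unit `a` of absolute value one with `χ₁ a ≠ 1` (`hFε`: sub-branch (R-b), `χ₁|_{𝒪_F^×} = ε`);
letters `V₁, V₂ ≠ 0`, `Γ`; `X = χ₁(σΠ·Π)` with `|X| < 1`, `q = N𝔓_w`; `Λ11 = V₁·Γ·X∕(1−X)` (`Λ_1 f₁`), `Λww = V₂·Γ·X∕(1−X)` (`Λ_{w₀} f_w`), `Λ1w = (q^ν)⁻¹V₁` (`Λ_1 f_w`),
`Λw1 = (q^ν)⁻¹V₂` (`Λ_{w₀} f₁`), `Γ²X = (q−1)²(q^{2ν+1})⁻¹`, and `Λ11·Λww − Λw1·Λ1w = 0` (★ (B-0) `R90S1BranchBDeterminantVanishingCells`).  Then **`χ₁ = η·‖·‖^{1∕2}` for a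
continuous quadratic character extension `η`** — DISJUNCT 2 of U4Keys :182: §2 gives `X = (N𝔓_w)⁻¹` (`1 < N𝔓_w` ★ `NumberField.HeightOneSpectrum.one_lt_absNorm`), ★
`coe_halfModulusChar_norm_uniformizer` reads it as ★ (7a)'s `hroot : χ₁(σΠ·Π) = halfModulusChar(σΠ·Π)`, and ★ (7a) `exists_eta_of_branchB_of_apply_norm_uniformizer_of_fixedUnit`
converts. [cite: Keys1984, §7 Theorem (2) (d) p. 126] [cite: Casselman1980, §3] [cite: Rogawski1990, §12.2 (1)–(2) p. 173] -/
theorem exists_eta_of_det_eq_zero_of_pairEntries_ram_posDepth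
    (piU : (LocalRing L v)ˣ) (hpiU : ∀ w' : PlacesOver L v, Valued.v ((piU : LocalRing L v) w') = WithZero.exp (-1 : ℤ))
    (χ₁ : (LocalRing L v)ˣ →* ℂˣ) (h₁ : Continuous (fun x => ((χ₁ x : ℂˣ) : ℂ)))
    (hB : ∀ u : (LocalRing L v)ˣ, (∀ w' : PlacesOver L v, Valued.v ((u : LocalRing L v) w') = 1) →
      χ₁ (u * Units.map (conjLocal L (IsCMField.complexConj L) v : LocalRing L v →* LocalRing L v) u) = 1)
    (hFε : ∃ a : (LocalRing L v)ˣ, Units.map (conjLocal L (IsCMField.complexConj L) v : LocalRing L v →* LocalRing L v) a = a ∧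
      (∀ w' : PlacesOver L v, Valued.v ((a : LocalRing L v) w') = 1) ∧ χ₁ a ≠ 1)
    (ν : ℕ) (Γ V₁ V₂ Λ11 Λ1w Λw1 Λww : ℂ) (hV₁ : V₁ ≠ 0) (hV₂ : V₂ ≠ 0)
    (hX : ‖((χ₁ (Units.map (conjLocal L (IsCMField.complexConj L) v : LocalRing L v →* LocalRing L v) piU * piU) : ℂˣ) : ℂ)‖ < 1)
    (h11v : Λ11 = V₁ * (Γ * ((χ₁ (Units.map (conjLocal L (IsCMField.complexConj L) v : LocalRing L v →* LocalRing L v) piU * piU) : ℂˣ) : ℂ) /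
      (1 - ((χ₁ (Units.map (conjLocal L (IsCMField.complexConj L) v : LocalRing L v →* LocalRing L v) piU * piU) : ℂˣ) : ℂ))))
    (hwwv : Λww = V₂ * (Γ * ((χ₁ (Units.map (conjLocal L (IsCMField.complexConj L) v : LocalRing L v →* LocalRing L v) piU * piU) : ℂˣ) : ℂ) /
      (1 - ((χ₁ (Units.map (conjLocal L (IsCMField.complexConj L) v : LocalRing L v →* LocalRing L v) piU * piU) : ℂˣ) : ℂ))))
    (h1wv : Λ1w = (((Ideal.absNorm w.1.asIdeal : ℝ) : ℂ) ^ ν)⁻¹ * V₁) (hw1v : Λw1 = (((Ideal.absNorm w.1.asIdeal : ℝ) : ℂ) ^ ν)⁻¹ * V₂)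
    (hΓ : Γ ^ 2 * ((χ₁ (Units.map (conjLocal L (IsCMField.complexConj L) v : LocalRing L v →* LocalRing L v) piU * piU) : ℂˣ) : ℂ) =
      (((Ideal.absNorm w.1.asIdeal : ℝ) : ℂ) - 1) ^ 2 * ((((Ideal.absNorm w.1.asIdeal : ℝ) : ℂ)) ^ (2 * ν + 1))⁻¹)
    (hdet : Λ11 * Λww - Λw1 * Λ1w = 0) :
    ∃ η : (LocalRing L v)ˣ →* ℂˣ, IsQuadraticCharExtension (conjLocal L (IsCMField.complexConj L) v) η ∧
      Continuous (fun x => ((η x : ℂˣ) : ℂ)) ∧ χ₁ = η * halfModulusChar (LocalRing L v) := by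
  have hq : (1 : ℝ) < (Ideal.absNorm w.1.asIdeal : ℝ) := by exact_mod_cast NumberField.HeightOneSpectrum.one_lt_absNorm w.1
  have hroot0 := eq_inv_of_det_eq_zero_ram_posDepth (Ideal.absNorm w.1.asIdeal : ℝ) hq ν _ Γ V₁ V₂ Λ11 Λ1w Λw1 Λww hX hV₁ hV₂ h11v hwwv h1wv hw1v hΓ hdet
  rw [Complex.ofReal_natCast] at hroot0
  have hroot : χ₁ (Units.map (conjLocal L (IsCMField.complexConj L) v : LocalRing L v →* LocalRing L v) piU * piU) =
      halfModulusChar (LocalRing L v) (Units.map (conjLocal L (IsCMField.complexConj L) v : LocalRing L v →* LocalRing L v) piU * piU) :=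
    Units.ext (by rw [hroot0, coe_halfModulusChar_norm_uniformizer L v hns w hw piU hpiU])
  exact BposRamConversion.exists_eta_of_branchB_of_apply_norm_uniformizer_of_fixedUnit L v hns w hw piU hpiU χ₁ h₁ hB hFε hroot

end CM

/-! ## §4 Sub-branch (R-a): the determinant does NOT vanish -/

/-- **(R-a) — `G₁ = G₂ = 0` ⟹ `det M = −(q^ν)⁻²·V₁V₂ ≠ 0`**: in the sub-branch `χ₁|_{𝒪_F^×} = 1` every shell of the two big-cell entries vanishes (paper §2), so with the two
volumes `(q^ν)⁻¹V₁`, `(q^ν)⁻¹V₂` (`q, V₁, V₂ ≠ 0`) the Casselman-pair determinant is `−(q^ν)⁻²V₁V₂ ≠ 0` and «reducible ⟹ det M = 0» (★ (B-0)) is ABSURD — the leaf's (R-a) branch.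
[cite: Keys1984, §7 Theorem (2) (d) p. 126] [cite: Casselman1980, §3] -/
theorem det_ne_zero_of_bigCell_zero_ram (q V₁ V₂ Λ11 Λ1w Λw1 Λww : ℂ) (ν : ℕ) (hq : q ≠ 0) (hV₁ : V₁ ≠ 0) (hV₂ : V₂ ≠ 0)
    (h11 : Λ11 = 0) (hww : Λww = 0) (h1w : Λ1w = (q ^ ν)⁻¹ * V₁) (hw1 : Λw1 = (q ^ ν)⁻¹ * V₂) :
    Λ11 * Λww - Λw1 * Λ1w ≠ 0 := by
  rw [h11, hww, h1w, hw1, zero_mul, zero_sub, neg_ne_zero]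
  exact mul_ne_zero (mul_ne_zero (inv_ne_zero (pow_ne_zero ν hq)) hV₂) (mul_ne_zero (inv_ne_zero (pow_ne_zero ν hq)) hV₁)

end Summit.HodgeConjecture.HodgeConjecture.R90.S1.BposRamDeterminantClosedForm

end
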